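import Literature.InformationTheory.QuantumCodes.ToricCodePhenomenological
import Literature.InformationTheory.QuantumCodes.ToricCodePolygons
import HarnessLib

/-!
# Self-avoiding polygons on the SPACE-TIME lattice of the toric code with noisy syndrome
# measurement: links, end sites, the space-time cycle they carry, and their number
# (`n_SAP(ℓ) ≤ L²(T+1) · c_{ℓ-1}(ℤ³)`)

Topic `Literature/InformationTheory/QuantumCodes` (venture QEC, LADDER-QEC rung Q5, PARTITION row 09
"phenomenological"). First theorem file towards the discharge of the two named facts of
`ToricCodePhenomenological.lean` (qec-type-09): `ToricCode.phenomFailureProb_le_of_sawCountBound` and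
`ToricCode.phenomThreshold_of_sawCountBound` — the Dennis–Kitaev–Landahl–Preskill counting bound for
the `T`-round memory experiment (DKLP §5.2–5.3). It is the space-time twin of `ToricCodePolygons.lean`
(qec-lit-2, the perfect-measurement case).

**The ambient lattice.** The space-time sites `STSite L T = Vertex L × Fin (T+1)` and links
`STLink L T` (horizontal `(ℓ, t)`, vertical `(s, t)`) of the statement file are embedded (`stSiteOf`,
`stLinkOf`, both injective) in the AMBIENT lattice `Vertex L × ℤ` (all integer times), whose links
`STALink L = (Edge L × ℤ) ⊕ (Vertex L × ℤ)` have end sites `stEnds` ("horizontal links … vertical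
links", DKLP §4.2). Lattice paths are coded, as in the tree's self-avoiding-walk files
(`SAW.Zd.Word`, `d = 3`: step words `w : List (Fin 3 × Bool)`, letters `± e₀, ± e₁` spatial and
`± e₂` temporal), by a start site `x` and a word `w`: sites `stPos x w i = x + (traj w i reduced
mod L in space)`, link of step `k` = `stEdgeAt x w k`. Working in the ambient group `Vertex L × ℤ`
keeps the walk combinatorics free of range bookkeeping; the range enters only through
"the links lie in the image of `stLinkOf`".

* `stSyn_single` — the space-time boundary of one link is the indicator of its two end sites
  (`L ≥ 2`), the bridge between `stMatrix` of the statement file and `stEnds`;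
* `IsSTPolygon x w` — self-avoiding polygon (`|w| ≥ 3`, closed, sites distinct); its links are
  distinct (`IsSTPolygon.stEdgeAt_injOn`);
* `stPolygonChain x w` — the history (`ℤ₂`-chain on `STLink L T`) carried by the polygon; for a
  closed path whose links are in range it is a space-time CYCLE (`stPolygonChain_mem_stCycles`:
  the boundary telescopes), and its support has `|w|` links;
* `stEnds_injective` (`L ≥ 3`) — a link is determined by its end sites;
* **`card_stPolygons_le`** — the supports of the self-avoiding polygons with `ℓ` links in range
  number at most `L²(T+1) · #sawWords 3 (ℓ-1)` ("Such an SAW can begin at any one of `L²·T`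
  lattice sites", and the first `ℓ-1` steps lift to a self-avoiding walk of `ℤ³`).

## References

* [DennisEtAl2002] E. Dennis, A. Kitaev, A. Landahl, J. Preskill, *Topological quantum memory*,
  J. Math. Phys. 43 (2002) 4452–4505, arXiv:quant-ph/0110143, §4.2 (space-time lattice: horizontal
  and vertical links, time slices), §4.3 (boundary of a chain), §5.2 (self-avoiding polygons,
  eqs. (e_ineq)–(saw_L)), §5.3 (counting by self-avoiding walks of ℤ³, eqs. (saw_d), (saw_3)).
* [MadrasSlade1993] N. Madras, G. Slade, *The Self-Avoiding Walk*, Birkhäuser 1993, §1.1 (step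
  words; the tree's `SAW.Zd.Word`).
-/

namespace Literature.InformationTheory.QuantumCodes

namespace ToricCode

open Finset Matrix
open Literature.Probability.LatticeModels (TorusSite Site Torus.proj)
open Literature.Probability.Percolation (stepVec)
open Literature.Probability.RandomPlanarGeometry.SAW.Zd

variable {L T : ℕ}

/-! ### The ambient space-time lattice `Vertex L × ℤ` and the embedding of the window -/

variable (L) in
/-- Ambient space-time sites: a toric-lattice site and an INTEGER time (all time slices, not only
`0, …, T`). [cite: DennisEtAl2002, §4.2 (three-dimensional lattice, integer time)] -/
abbrev STASite : Type := Vertex L × ℤ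

variable (L) in
/-- Ambient space-time links: horizontal `Sum.inl (ℓ, τ)` (the toric link `ℓ` in slice `τ`) and
vertical `Sum.inr (s, τ)` (joining the site `s` of slice `τ` to slice `τ + 1`).
[cite: DennisEtAl2002, §4.2 (horizontal links, vertical links)] -/
abbrev STALink : Type := (Edge L × ℤ) ⊕ (Vertex L × ℤ)

/-- The embedding of the sites of the `T`-round window into the ambient lattice.
[cite: DennisEtAl2002, §4.2 (time slices)] -/
def stSiteOf (x : STSite L T) : STASite L := (x.1, ((x.2 : ℕ) : ℤ))

/-- The embedding of the links of the `T`-round window into the ambient lattice.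
[cite: DennisEtAl2002, §4.2 (horizontal and vertical links)] -/
def stLinkOf : STLink L T → STALink L :=
  Sum.map (fun et => (et.1, ((et.2 : ℕ) : ℤ))) (fun vt => (vt.1, ((vt.2 : ℕ) : ℤ)))

/-- The site embedding is injective (distinct slices have distinct integer times).
[cite: DennisEtAl2002, §4.2 (time slices of the space-time lattice)] -/
theorem stSiteOf_injective : Function.Injective (stSiteOf : STSite L T → STASite L) := by
  rintro ⟨v, t⟩ ⟨v', t'⟩ h
  simp only [stSiteOf, Prod.mk.injEq, Nat.cast_inj] at h
  exact Prod.ext h.1 (Fin.ext h.2)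

/-- The link embedding is injective. [cite: DennisEtAl2002, §4.2 (horizontal and vertical links of the space-time lattice)] -/
theorem stLinkOf_injective : Function.Injective (stLinkOf : STLink L T → STALink L) := by
  rintro (⟨e, t⟩ | ⟨v, t⟩) (⟨e', t'⟩ | ⟨v', t'⟩) h <;>
    simp only [stLinkOf, Sum.map_inl, Sum.map_inr, Sum.inl.injEq, Sum.inr.injEq, Prod.mk.injEq,
      Nat.cast_inj, reduceCtorEq] at h
  · exact congrArg Sum.inl (Prod.ext h.1 (Fin.ext h.2))
  · exact congrArg Sum.inr (Prod.ext h.1 (Fin.ext h.2))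

/-- The link embedding as an embedding of finite sets (plumbing for `Finset.map`).
[cite: DennisEtAl2002, §4.2 (horizontal and vertical links of the space-time lattice)] -/
def stLinkEmb : STLink L T ↪ STALink L := ⟨stLinkOf, stLinkOf_injective⟩

/-- The link embedding of finite sets is `stLinkOf`. [cite: DennisEtAl2002, §4.2 (horizontal and vertical links of the space-time lattice)] -/
@[simp] theorem stLinkEmb_apply (ℓ : STLink L T) : stLinkEmb ℓ = stLinkOf ℓ := rfl

/-- The ambient sites in the window are those with time in `[0, T]`. [cite: DennisEtAl2002, §4.2 (time slices)] -/
theorem mem_range_stSiteOf {y : STASite L} :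
    y ∈ Set.range (stSiteOf : STSite L T → STASite L) ↔ 0 ≤ y.2 ∧ y.2 ≤ T := by
  constructor
  · rintro ⟨⟨v, t⟩, rfl⟩
    simp only [stSiteOf]
    exact ⟨by positivity, by exact_mod_cast Nat.le_of_lt_succ t.isLt⟩
  · rintro ⟨h0, hT⟩
    obtain ⟨v, τ⟩ := y
    simp only at h0 hT
    obtain ⟨n, rfl⟩ := Int.eq_ofNat_of_zero_le h0
    exact ⟨(v, ⟨n, by omega⟩), rfl⟩

/-! ### End sites of links and the space-time boundary of a single link -/

/-- The two end sites of an ambient link: `{(u, τ), (u + eᵢ, τ)}` for the horizontal link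
`((u, i), τ)`, `{(s, τ), (s, τ+1)}` for the vertical link `(s, τ)`.
[cite: DennisEtAl2002, §4.2 (horizontal links within a slice, vertical links between slices)] -/
def stEnds : STALink L → Sym2 (STASite L)
  | Sum.inl (e, τ) => s((e.1, τ), (e.1 + dir e.2, τ))
  | Sum.inr (v, τ) => s((v, τ), (v, τ + 1))

/-- The first end site of a link (`(u, τ)` resp. `(s, τ)`). [cite: DennisEtAl2002, §4.2] -/
def stFstEnd : STALink L → STASite L
  | Sum.inl (e, τ) => (e.1, τ)
  | Sum.inr (v, τ) => (v, τ)

/-- The first end site is an end site. [cite: DennisEtAl2002, §4.2] -/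
theorem stFstEnd_mem_stEnds (a : STALink L) : stFstEnd a ∈ stEnds a := by
  rcases a with ⟨e, τ⟩ | ⟨v, τ⟩ <;> simp [stFstEnd, stEnds]

/-- The unit vectors of the torus are non-zero for `L ≥ 2`. [folklore] -/
private theorem dir_ne_zero' (hL : 2 ≤ L) (i : Fin 2) : (dir i : Vertex L) ≠ 0 := by
  intro h
  have h1 := congrFun h i
  simp only [dir, Pi.single_eq_same, Pi.zero_apply] at h1
  haveI : Fact (1 < L) := ⟨hL⟩
  exact one_ne_zero h1

/-- The two end sites of a link are distinct (`L ≥ 2`). [cite: DennisEtAl2002, §4.2] -/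
theorem stEnds_eq_pair (hL : 2 ≤ L) (a : STALink L) :
    ∃ y y' : STASite L, y ≠ y' ∧ stEnds a = s(y, y') := by
  rcases a with ⟨e, τ⟩ | ⟨v, τ⟩
  · refine ⟨(e.1, τ), (e.1 + dir e.2, τ), ?_, rfl⟩
    intro h
    have h1 : e.1 = e.1 + dir e.2 := congrArg Prod.fst h
    exact dir_ne_zero' hL e.2 (left_eq_add.1 h1)
  · refine ⟨(v, τ), (v, τ + 1), ?_, rfl⟩
    intro h
    have h1 : τ = τ + 1 := congrArg Prod.snd h
    omega

/-- The end sites of a link of the window lie in the window. [cite: DennisEtAl2002, §4.2 (time slices 0, …, T)] -/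
theorem mem_range_stSiteOf_of_mem_stEnds (ℓ : STLink L T) {y : STASite L}
    (hy : y ∈ stEnds (stLinkOf ℓ)) : y ∈ Set.range (stSiteOf : STSite L T → STASite L) := by
  rw [mem_range_stSiteOf]
  rcases ℓ with ⟨e, t⟩ | ⟨v, t⟩
  · simp only [stLinkOf, Sum.map_inl, stEnds, Sym2.mem_iff] at hy
    have ht := t.isLt
    rcases hy with rfl | rfl <;> exact ⟨by positivity, by exact_mod_cast by omega⟩
  · simp only [stLinkOf, Sum.map_inr, stEnds, Sym2.mem_iff] at hy
    have ht := t.isLt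
    rcases hy with rfl | rfl
    · exact ⟨by positivity, by exact_mod_cast by omega⟩
    · refine ⟨by positivity, ?_⟩
      push_cast
      exact_mod_cast ht

/-- In `ℤ₂`, the indicator of an unordered pair of DISTINCT sites is the sum of the two point
indicators (the boundary of a link is the sum of its two end sites).
[cite: DennisEtAl2002, §4.3 (the boundary of an error chain)] -/
theorem ite_mem_pair_eq_add {α : Type*} [DecidableEq α] {a b : α} (hab : a ≠ b) (y : α) :
    (if y ∈ s(a, b) then (1 : ZMod 2) else 0) = (if y = a then 1 else 0) + (if y = b then 1 else 0) := by
  simp only [Sym2.mem_iff]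
  by_cases ha : y = a
  · subst ha
    simp [hab]
  · by_cases hb : y = b
    · subst hb
      simp [ha]
    · simp [ha, hb]

/-- The star row of the toric code at the site `s` evaluated at the link `e` is the indicator of
"`s` is an end site of `e`" (`L ≥ 2`). [cite: DennisEtAl2002, §3.1 (X_s acts on the links meeting s)] -/
theorem starMatrix_apply_eq_ite (hL : 2 ≤ L) (s : Vertex L) (e : Edge L) :
    starMatrix L s e = if s ∈ toSym2 e then 1 else 0 := by
  haveI : NeZero L := ⟨by omega⟩
  have h := starMatrix_mulVec_single (L := L) e s
  have hm : (starMatrix L *ᵥ Pi.single e (1 : ZMod 2)) s = starMatrix L s e := by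
    simp only [Matrix.mulVec, dotProduct, Pi.single_apply, mul_ite, mul_one, mul_zero,
      Finset.sum_ite_eq', Finset.mem_univ, if_true]
  rw [← hm, h, toSym2]
  have hne : e.1 ≠ e.1 + dir e.2 := fun h' => dir_ne_zero' hL e.2 (left_eq_add.1 h')
  rw [ite_mem_pair_eq_add hne]
  simp only [Pi.single_apply]

/-- **The space-time boundary of a single link is the indicator of its two end sites**
(`L ≥ 2`): `(∂ 𝟙_ℓ)(x) = 1` iff `x` is an end site of `ℓ`. This is the bridge between the
statement file's `stMatrix` and the end-site map `stEnds`. [cite: DennisEtAl2002, §4.3 (the boundary of a chain)] -/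
theorem stSyn_single [NeZero L] (hL : 2 ≤ L) (ℓ : STLink L T) (x : STSite L T) :
    stSyn L T (Pi.single ℓ 1) x = if stSiteOf x ∈ stEnds (stLinkOf ℓ) then 1 else 0 := by
  have hm : stSyn L T (Pi.single ℓ 1) x = stMatrix L T x ℓ := by
    simp only [stSyn, Matrix.mulVec, dotProduct, Pi.single_apply, mul_ite, mul_one, mul_zero,
      Finset.sum_ite_eq', Finset.mem_univ, if_true]
  rw [hm]
  obtain ⟨v, τ⟩ := x
  rcases ℓ with ⟨e, t⟩ | ⟨s, t⟩
  · simp only [stMatrix, of_apply, Sum.elim_inl, stLinkOf, Sum.map_inl, stEnds, stSiteOf,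
      Sym2.mem_iff, Prod.mk.injEq]
    rw [starMatrix_apply_eq_ite hL, toSym2]
    simp only [Sym2.mem_iff]
    have hτ : τ = t.castSucc ↔ ((τ : ℕ) : ℤ) = ((t : ℕ) : ℤ) := by
      rw [Nat.cast_inj, Fin.ext_iff]; rfl
    by_cases h1 : τ = t.castSucc
    · have h2 := hτ.1 h1
      rw [if_pos h1]
      have key : (v = e.1 ∨ v = e.1 + dir e.2) ↔
          ((v = e.1 ∧ ((τ : ℕ) : ℤ) = ((t : ℕ) : ℤ)) ∨ (v = e.1 + dir e.2 ∧ ((τ : ℕ) : ℤ) = ((t : ℕ) : ℤ))) := by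
        tauto
      by_cases hc : v = e.1 ∨ v = e.1 + dir e.2
      · rw [if_pos hc, if_pos (key.1 hc)]
      · rw [if_neg hc, if_neg (fun h => hc (key.2 h))]
    · have h2 : ¬ ((τ : ℕ) : ℤ) = ((t : ℕ) : ℤ) := fun h => h1 (hτ.2 h)
      rw [if_neg h1, if_neg (by tauto)]
  · simp only [stMatrix, of_apply, Sum.elim_inr, stLinkOf, Sum.map_inr, stEnds, stSiteOf,
      Sym2.mem_iff, Prod.mk.injEq]
    have hτ1 : τ = t.castSucc ↔ ((τ : ℕ) : ℤ) = ((t : ℕ) : ℤ) := by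
      rw [Nat.cast_inj, Fin.ext_iff]; rfl
    have hτ2 : τ = t.succ ↔ ((τ : ℕ) : ℤ) = ((t : ℕ) : ℤ) + 1 := by
      rw [Fin.ext_iff, Fin.val_succ]
      constructor
      · intro h; rw [h]; push_cast; ring
      · intro h; exact_mod_cast h
    have key : (v = s ∧ (τ = t.castSucc ∨ τ = t.succ)) ↔
        ((v = s ∧ ((τ : ℕ) : ℤ) = ((t : ℕ) : ℤ)) ∨ (v = s ∧ ((τ : ℕ) : ℤ) = ((t : ℕ) : ℤ) + 1)) := by
      rw [hτ1, hτ2]; tauto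
    by_cases hc : v = s ∧ (τ = t.castSucc ∨ τ = t.succ)
    · rw [if_pos hc, if_pos (key.1 hc)]
    · rw [if_neg hc, if_neg (fun h => hc (key.2 h))]

/-! ### Step words of `ℤ³` acting on the ambient lattice -/

/-- Reduction of a displacement of `ℤ³` to the ambient lattice: the two spatial coordinates mod
`L`, the time coordinate kept. [cite: DennisEtAl2002, §5.3 (walks on the simple (hyper)cubic lattice)] -/
def stProj (y : Site 3) : STASite L := (fun j : Fin 2 => ((y j.castSucc : ℤ) : ZMod L), y 2)

/-- The reduction is additive. [cite: MadrasSlade1993, §1.1 (sites of ℤ^d and their translates)] -/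
theorem stProj_add (y y' : Site 3) : (stProj (y + y') : STASite L) = stProj y + stProj y' := by
  ext j <;> simp [stProj]

/-- The reduction of the origin. [cite: MadrasSlade1993, §1.1 (walks start at the origin)] -/
@[simp] theorem stProj_zero : (stProj (0 : Site 3) : STASite L) = 0 := by
  ext j <;> simp [stProj]

/-- The three positive unit steps of the ambient lattice: `e₀, e₁` spatial, `e₂` temporal.
[cite: DennisEtAl2002, §4.2 (horizontal and vertical links)] -/
def stDir : Fin 3 → STASite L
  | ⟨0, _⟩ => (dir 0, 0)
  | ⟨1, _⟩ => (dir 1, 0)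
  | ⟨2, _⟩ => (0, 1)

/-- The reduction of a unit step `± eᵢ` of `ℤ³` is `± stDir i`. [cite: MadrasSlade1993, §1.1 (nearest-neighbour steps ± eᵢ)] -/
theorem stProj_stepVec (a : Fin 3 × Bool) :
    (stProj (stepVec a) : STASite L) = if a.2 then stDir a.1 else -stDir a.1 := by
  obtain ⟨i, b⟩ := a
  fin_cases i <;> cases b <;> ext j <;> (try fin_cases j) <;>
    simp [stProj, stepVec, stDir, dir, Pi.single_apply]

/-- The unit steps are non-zero on the ambient lattice (`L ≥ 2`). [cite: DennisEtAl2002, §4.2 (links join distinct sites of the space-time lattice)] -/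
theorem stDir_ne_zero (hL : 2 ≤ L) (i : Fin 3) : (stDir i : STASite L) ≠ 0 := by
  fin_cases i
  · exact fun h => dir_ne_zero' hL 0 (congrArg Prod.fst h)
  · exact fun h => dir_ne_zero' hL 1 (congrArg Prod.fst h)
  · intro h
    have := congrArg Prod.snd h
    simp [stDir] at this

/-- The reduction of a unit step is non-zero (`L ≥ 2`): consecutive sites of a lattice path differ.
[cite: DennisEtAl2002, §4.2 (links join distinct sites of the space-time lattice)] -/
theorem stProj_stepVec_ne_zero (hL : 2 ≤ L) (a : Fin 3 × Bool) :
    (stProj (stepVec a) : STASite L) ≠ 0 := by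
  rw [stProj_stepVec]
  split_ifs
  · exact stDir_ne_zero hL a.1
  · exact neg_ne_zero.2 (stDir_ne_zero hL a.1)

/-- The site reached after `i` steps of the word `w` from `x` (frozen at the end for `i ≥ |w|`).
[cite: DennisEtAl2002, §5.2 (lattice paths)] -/
def stPos (x : STASite L) (w : List (Fin 3 × Bool)) (i : ℕ) : STASite L := x + stProj (Word.traj w i)

/-- The path starts at `x`. [cite: DennisEtAl2002, §5.2] -/
@[simp] theorem stPos_zero (x : STASite L) (w : List (Fin 3 × Bool)) : stPos x w 0 = x := by
  simp [stPos]

/-- One step: `stPos x w (i+1) = stPos x w i ± e`. [cite: DennisEtAl2002, §5.2] -/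
theorem stPos_succ (x : STASite L) (w : List (Fin 3 × Bool)) {i : ℕ} (hi : i < w.length) :
    stPos x w (i + 1) = stPos x w i + stProj (stepVec (w[i])) := by
  simp only [stPos, Word.traj_succ w hi, stProj_add, add_assoc]

/-- Consecutive sites of a path are distinct (`L ≥ 2`). [cite: DennisEtAl2002, §5.2] -/
theorem stPos_succ_ne (hL : 2 ≤ L) (x : STASite L) (w : List (Fin 3 × Bool)) {i : ℕ}
    (hi : i < w.length) : stPos x w (i + 1) ≠ stPos x w i := by
  rw [stPos_succ x w hi]
  intro h
  exact stProj_stepVec_ne_zero hL _ (add_eq_left.1 h)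

/-- The path of a prefix agrees with the original up to its length. [cite: MadrasSlade1993, §1.1] -/
theorem stPos_take (x : STASite L) (w : List (Fin 3 × Bool)) {i k : ℕ} (hik : i ≤ k) :
    stPos x (w.take k) i = stPos x w i := by
  simp only [stPos, Word.traj_take w hik]

/-- The path of `w ++ w'` up to time `|w|` is that of `w`. [cite: MadrasSlade1993, §1.1] -/
theorem stPos_append_left (x : STASite L) (w w' : List (Fin 3 × Bool)) {i : ℕ} (hi : i ≤ w.length) :
    stPos x (w ++ w') i = stPos x w i := by
  simp only [stPos, Word.traj_append_left w w' hi]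

/-- The path of `w ++ w'` after time `|w|` is the path of `w'` from the end of `w`. [cite: MadrasSlade1993, §1.1] -/
theorem stPos_append_right (x : STASite L) (w w' : List (Fin 3 × Bool)) (i : ℕ) :
    stPos x (w ++ w') (w.length + i) = stPos (stPos x w w.length) w' i := by
  simp only [stPos, Word.traj_append_right, stProj_add, Word.traj_length, add_assoc]

/-- The path of the suffix `w.drop i` from the site `stPos x w i` is the rest of the path.
[cite: MadrasSlade1993, §1.1] -/
theorem stPos_drop (x : STASite L) (w : List (Fin 3 × Bool)) {i : ℕ} (hi : i ≤ w.length) (k : ℕ) :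
    stPos (stPos x w i) (w.drop i) k = stPos x w (i + k) := by
  have hlen : (w.take i).length = i := by simp [min_eq_left hi]
  have h := stPos_append_right x (w.take i) (w.drop i) k
  rw [List.take_append_drop, hlen, stPos_take x w le_rfl] at h
  exact h.symm

/-! ### The link of a step -/

/-- The ambient link traversed by the step `a = ± eᵢ` from the site `x = (v, τ)`: for `+e₀, +e₁`
the horizontal link `((v, i), τ)`, for `-eᵢ` the link `((v - eᵢ, i), τ)`, for `+e₂` the vertical
link `(v, τ)` and for `-e₂` the vertical link `(v, τ - 1)`.
[cite: DennisEtAl2002, §4.2 (horizontal and vertical links)] -/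
def stStepLink (x : STASite L) : Fin 3 × Bool → STALink L
  | (⟨0, _⟩, true) => Sum.inl ((x.1, 0), x.2)
  | (⟨0, _⟩, false) => Sum.inl ((x.1 - dir 0, 0), x.2)
  | (⟨1, _⟩, true) => Sum.inl ((x.1, 1), x.2)
  | (⟨1, _⟩, false) => Sum.inl ((x.1 - dir 1, 1), x.2)
  | (⟨2, _⟩, true) => Sum.inr (x.1, x.2)
  | (⟨2, _⟩, false) => Sum.inr (x.1, x.2 - 1)

/-- The end sites of the link of a step are the sites before and after the step.
[cite: DennisEtAl2002, §5.2 (links of a lattice path)] -/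
theorem stEnds_stStepLink (x : STASite L) (a : Fin 3 × Bool) :
    stEnds (stStepLink x a) = s(x, x + stProj (stepVec a)) := by
  rw [stProj_stepVec]
  obtain ⟨v, τ⟩ := x
  obtain ⟨i, b⟩ := a
  fin_cases i <;> cases b <;> simp [stStepLink, stEnds, stDir, Sym2.eq_swap, sub_eq_add_neg]

/-- From an end site `y` of a link there is a step traversing the link.
[cite: DennisEtAl2002, §5.2 (links of a lattice path)] -/
theorem exists_stStepLink_eq_of_mem_stEnds {y : STASite L} {a : STALink L} (h : y ∈ stEnds a) :
    ∃ c : Fin 3 × Bool, stStepLink y c = a := by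
  rcases a with ⟨⟨u, i⟩, τ⟩ | ⟨v, τ⟩
  · simp only [stEnds, Sym2.mem_iff] at h
    rcases h with rfl | rfl
    · fin_cases i
      · exact ⟨(0, true), rfl⟩
      · exact ⟨(1, true), rfl⟩
    · fin_cases i
      · exact ⟨(0, false), by simp [stStepLink]⟩
      · exact ⟨(1, false), by simp [stStepLink]⟩
  · simp only [stEnds, Sym2.mem_iff] at h
    rcases h with rfl | rfl
    · exact ⟨(2, true), rfl⟩
    · exact ⟨(2, false), by simp [stStepLink]⟩

/-- The link traversed at step `k` of the word `w` from `x` (junk for `k ≥ |w|`).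
[cite: DennisEtAl2002, §5.2 (links of a lattice path)] -/
def stEdgeAt (x : STASite L) (w : List (Fin 3 × Bool)) (k : ℕ) : STALink L :=
  stStepLink (stPos x w k) (w.getD k (0, true))

/-- The link of step `k` joins the sites `k` and `k+1` of the path. [cite: DennisEtAl2002, §5.2] -/
theorem stEnds_stEdgeAt (x : STASite L) (w : List (Fin 3 × Bool)) {k : ℕ} (hk : k < w.length) :
    stEnds (stEdgeAt x w k) = s(stPos x w k, stPos x w (k + 1)) := by
  rw [stEdgeAt, stEnds_stStepLink, stPos_succ x w hk, List.getD_eq_getElem?_getD,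
    List.getElem?_eq_getElem hk, Option.getD_some]

/-- The links of a prefix are those of the word. [cite: MadrasSlade1993, §1.1] -/
theorem stEdgeAt_take (x : STASite L) (w : List (Fin 3 × Bool)) {k n : ℕ} (hk : k < n) :
    stEdgeAt x (w.take n) k = stEdgeAt x w k := by
  unfold stEdgeAt
  rw [stPos_take x w hk.le, List.getD_eq_getElem?_getD, List.getD_eq_getElem?_getD,
    List.getElem?_take_of_lt hk]

/-- The links of `w ++ w'` before time `|w|` are those of `w`. [cite: MadrasSlade1993, §1.1] -/
theorem stEdgeAt_append_left (x : STASite L) (w w' : List (Fin 3 × Bool)) {k : ℕ} (hk : k < w.length) :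
    stEdgeAt x (w ++ w') k = stEdgeAt x w k := by
  unfold stEdgeAt
  rw [stPos_append_left x w w' hk.le, List.getD_eq_getElem?_getD, List.getD_eq_getElem?_getD,
    List.getElem?_append_left hk]

/-- The link of `w ++ [a]` at time `|w|` is the link of the step `a` from the end of `w`.
[cite: MadrasSlade1993, §1.1] -/
theorem stEdgeAt_append_single (x : STASite L) (w : List (Fin 3 × Bool)) (a : Fin 3 × Bool) :
    stEdgeAt x (w ++ [a]) w.length = stStepLink (stPos x w w.length) a := by
  unfold stEdgeAt
  rw [stPos_append_left x w [a] le_rfl, List.getD_eq_getElem?_getD,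
    List.getElem?_append_right le_rfl]
  simp

/-- The links of the suffix `w.drop i` from `stPos x w i` are the later links of `w`.
[cite: MadrasSlade1993, §1.1] -/
theorem stEdgeAt_drop (x : STASite L) (w : List (Fin 3 × Bool)) {i : ℕ} (hi : i ≤ w.length) (k : ℕ) :
    stEdgeAt (stPos x w i) (w.drop i) k = stEdgeAt x w (i + k) := by
  unfold stEdgeAt
  rw [stPos_drop x w hi k, List.getD_eq_getElem?_getD, List.getD_eq_getElem?_getD, List.getElem?_drop]

/-- The set of ambient links of the path `w` from `x`. [cite: DennisEtAl2002, §5.2 (links of a lattice path)] -/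
def stPolygonEdges (x : STASite L) (w : List (Fin 3 × Bool)) : Finset (STALink L) :=
  (range w.length).image (stEdgeAt x w)

/-- The start site of a path with at least one link, all of whose links are in the window, is in
the window. [cite: DennisEtAl2002, §4.2 (time slices 0, …, T)] -/
theorem mem_range_stSiteOf_of_stPolygonEdges_subset {x : STASite L} {w : List (Fin 3 × Bool)}
    (hw : 0 < w.length)
    (hsub : ↑(stPolygonEdges x w) ⊆ Set.range (stLinkOf : STLink L T → STALink L)) :
    x ∈ Set.range (stSiteOf : STSite L T → STASite L) := by
  have h0 : stEdgeAt x w 0 ∈ stPolygonEdges x w := Finset.mem_image.2 ⟨0, Finset.mem_range.2 hw, rfl⟩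
  obtain ⟨ℓ, hℓ⟩ := hsub h0
  refine mem_range_stSiteOf_of_mem_stEnds ℓ ?_
  rw [hℓ, stEnds_stEdgeAt x w hw, Sym2.mem_iff]
  exact Or.inl (stPos_zero x w).symm

/-! ### Self-avoiding polygons -/

/-- **Self-avoiding polygon** on the space-time lattice, coded by a start site `x` of the ambient
lattice and a step word `w` of length `ℓ = |w| ≥ 3`: the path closes up after `ℓ` steps and its
first `ℓ` sites are pairwise distinct. [cite: DennisEtAl2002, §5.2 ("self-avoiding polygon")] -/
structure IsSTPolygon (x : STASite L) (w : List (Fin 3 × Bool)) : Prop where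
  /-- a polygon has at least three links -/
  three_le : 3 ≤ w.length
  /-- the path returns to its start -/
  closed : stPos x w w.length = x
  /-- the sites `0, …, ℓ-1` are distinct -/
  nodup : ∀ i j, i < w.length → j < w.length → stPos x w i = stPos x w j → i = j

namespace IsSTPolygon

variable {x : STASite L} {w : List (Fin 3 × Bool)}

/-- Site distinctness including the closing time `ℓ` (which carries the start site): for
`i, j ≤ ℓ` with equal sites, `i = j` or `{i, j} = {0, ℓ}`. [cite: DennisEtAl2002, §5.2 (self-avoiding polygon)] -/
theorem eq_or_of_stPos_eq (hP : IsSTPolygon x w) {i j : ℕ} (hi : i ≤ w.length) (hj : j ≤ w.length)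
    (h : stPos x w i = stPos x w j) : i = j ∨ (i = 0 ∧ j = w.length) ∨ (i = w.length ∧ j = 0) := by
  have key : ∀ i, i ≤ w.length → stPos x w i = stPos x w (if i = w.length then 0 else i) := by
    intro i hi
    split_ifs with h
    · rw [h, hP.closed, stPos_zero]
    · rfl
  have hlt : ∀ i, i ≤ w.length → (if i = w.length then 0 else i) < w.length := by
    intro i hi
    split_ifs with h
    · exact lt_of_lt_of_le (by norm_num) hP.three_le
    · exact lt_of_le_of_ne hi h
  rw [key i hi, key j hj] at h
  have := hP.nodup _ _ (hlt i hi) (hlt j hj) h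
  split_ifs at this with h1 h2 h2 <;> omega

/-- **The links of a self-avoiding polygon are distinct.** [cite: DennisEtAl2002, §5.2 (self-avoiding polygon of length H)] -/
theorem stEdgeAt_injOn (hP : IsSTPolygon x w) : Set.InjOn (stEdgeAt x w) (Set.Iio w.length) := by
  intro a ha b hb hab
  simp only [Set.mem_Iio] at ha hb
  have h := congrArg stEnds hab
  rw [stEnds_stEdgeAt x w ha, stEnds_stEdgeAt x w hb, Sym2.eq_iff] at h
  have h3 := hP.three_le
  rcases h with ⟨h1, -⟩ | ⟨h1, h2⟩
  · rcases hP.eq_or_of_stPos_eq ha.le hb.le h1 with h | h | h <;> omega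
  · rcases hP.eq_or_of_stPos_eq ha.le (Nat.succ_le_of_lt hb) h1 with h | h | h <;>
      rcases hP.eq_or_of_stPos_eq (Nat.succ_le_of_lt ha) hb.le h2 with h' | h' | h' <;> omega

/-- A self-avoiding polygon of length `ℓ` has exactly `ℓ` links. [cite: DennisEtAl2002, §5.2] -/
theorem card_stPolygonEdges (hP : IsSTPolygon x w) : (stPolygonEdges x w).card = w.length := by
  rw [stPolygonEdges, Finset.card_image_of_injOn (by simpa using hP.stEdgeAt_injOn), Finset.card_range]

/-- **The first `ℓ - 1` steps of a self-avoiding polygon form a self-avoiding walk of `ℤ³`** (a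
lattice path whose sites are distinct lifts to a self-avoiding walk).
[cite: DennisEtAl2002, §5.3 (polygons counted by self-avoiding walks)] -/
theorem isSAW_take (hP : IsSTPolygon x w) : Word.IsSAW (w.take (w.length - 1)) := by
  rw [Word.isSAW_iff_injOn]
  intro i hi j hj hij
  simp only [Set.mem_setOf_eq, List.length_take] at hi hj
  have hi' : i ≤ w.length - 1 := le_trans hi (min_le_left _ _)
  have hj' : j ≤ w.length - 1 := le_trans hj (min_le_left _ _)
  rw [Word.traj_take w hi', Word.traj_take w hj'] at hij
  have h3 := hP.three_le
  have ht : stPos x w i = stPos x w j := by simp only [stPos, hij]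
  exact hP.nodup i j (by omega) (by omega) ht

end IsSTPolygon

/-! ### The history carried by a path and its space-time boundary -/

/-- The pull-back to the window of the indicator of one ambient link (zero if the link is not in
the window). [cite: DennisEtAl2002, §4.4 (chains as ℤ₂-valued functions on links)] -/
def stPull (a : STALink L) : History L T := fun ℓ => if stLinkOf ℓ = a then 1 else 0

/-- The pull-back of a link of the window is its point indicator. [cite: DennisEtAl2002, §4.4] -/
theorem stPull_stLinkOf (ℓ₀ : STLink L T) : (stPull (stLinkOf ℓ₀) : History L T) = Pi.single ℓ₀ 1 := by
  funext ℓ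
  simp only [stPull, Pi.single_apply, stLinkOf_injective.eq_iff]

/-- The space-time boundary of (the pull-back of) a link of the window is the indicator of its end
sites (`L ≥ 2`). [cite: DennisEtAl2002, §4.3 (the boundary of a chain)] -/
theorem stSyn_stPull [NeZero L] (hL : 2 ≤ L) {a : STALink L}
    (ha : a ∈ Set.range (stLinkOf : STLink L T → STALink L)) (x : STSite L T) :
    stSyn L T (stPull a) x = if stSiteOf x ∈ stEnds a then 1 else 0 := by
  obtain ⟨ℓ₀, rfl⟩ := ha
  rw [stPull_stLinkOf, stSyn_single hL]

/-- The history (`ℤ₂`-chain on the links of the window) carried by the path `w` from `x`: the sum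
of the pull-backs of its links (a link traversed twice cancels).
[cite: DennisEtAl2002, §4.4 (chains as ℤ₂-valued functions on links)] -/
def stPolygonChain (x : STASite L) (w : List (Fin 3 × Bool)) : History L T :=
  ∑ k ∈ range w.length, stPull (stEdgeAt x w k)

/-- `x + x = 0` in `ℤ₂`. [folklore] -/
private theorem zmod2_add_self' (x : ZMod 2) : x + x = 0 := by
  revert x; decide

/-- Telescoping around a path, in `ℤ₂`: `Σ_{k<m} (f k + f (k+1)) = f 0 + f m`. [folklore] -/
private theorem zmod2_telescope' (f : ℕ → ZMod 2) (m : ℕ) :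
    ∑ k ∈ range m, (f k + f (k + 1)) = f 0 + f m := by
  induction m with
  | zero => simp [zmod2_add_self']
  | succ m ih =>
    rw [Finset.sum_range_succ, ih]
    have := zmod2_add_self' (f m)
    calc f 0 + f m + (f m + f (m + 1)) = f 0 + f (m + 1) + (f m + f m) := by ring
      _ = f 0 + f (m + 1) := by rw [this, add_zero]

/-- The space-time syndrome map is additive. [cite: DennisEtAl2002, §4.3 (∂ is linear)] -/
theorem stSyn_add [NeZero L] (E E' : History L T) : stSyn L T (E + E') = stSyn L T E + stSyn L T E' := by
  unfold stSyn
  exact Matrix.mulVec_add _ _ _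

/-- The space-time syndrome of a finite sum. [cite: DennisEtAl2002, §4.3 (∂ is linear)] -/
theorem stSyn_sum [NeZero L] {ι : Type*} (s : Finset ι) (f : ι → History L T) :
    stSyn L T (∑ i ∈ s, f i) = ∑ i ∈ s, stSyn L T (f i) := by
  unfold stSyn
  exact Matrix.mulVec_sum _ _ _

/-- **The history of a closed path whose links lie in the window is a space-time cycle**
(`L ≥ 2`): its boundary telescopes to `𝟙_x + 𝟙_x = 0`. [cite: DennisEtAl2002, §4.3 (a closed chain has no boundary)] -/
theorem stPolygonChain_mem_stCycles [NeZero L] (hL : 2 ≤ L) {x : STASite L} {w : List (Fin 3 × Bool)}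
    (hclosed : stPos x w w.length = x)
    (hsub : ↑(stPolygonEdges x w) ⊆ Set.range (stLinkOf : STLink L T → STALink L)) :
    (stPolygonChain x w : History L T) ∈ stCycles L T := by
  change stSyn L T (stPolygonChain x w) = 0
  unfold stPolygonChain
  funext y
  rw [stSyn_sum, Finset.sum_apply, Pi.zero_apply]
  have hterm : ∀ k ∈ range w.length, stSyn L T (stPull (stEdgeAt x w k) : History L T) y =
      (if stSiteOf y = stPos x w k then (1 : ZMod 2) else 0) +
        (if stSiteOf y = stPos x w (k + 1) then 1 else 0) := by
    intro k hk
    have hk' := Finset.mem_range.1 hk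
    rw [stSyn_stPull hL (hsub (Finset.mem_image.2 ⟨k, hk, rfl⟩)), stEnds_stEdgeAt x w hk',
      ite_mem_pair_eq_add (stPos_succ_ne hL x w hk').symm]
  rw [Finset.sum_congr rfl hterm,
    zmod2_telescope' (fun k => if stSiteOf y = stPos x w k then (1 : ZMod 2) else 0),
    hclosed, stPos_zero, zmod2_add_self']

/-- The history of a path whose links are distinct is the indicator of (the pull-back of) its link
set. [cite: DennisEtAl2002, §4.4 (n_E(ℓ) ∈ {0,1})] -/
theorem stPolygonChain_apply {x : STASite L} {w : List (Fin 3 × Bool)}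
    (hinj : Set.InjOn (stEdgeAt x w) (Set.Iio w.length)) (ℓ : STLink L T) :
    stPolygonChain x w ℓ = if stLinkOf ℓ ∈ stPolygonEdges x w then 1 else 0 := by
  classical
  unfold stPolygonChain
  rw [Finset.sum_apply]
  simp only [stPull]
  rw [Finset.sum_boole]
  split_ifs with h
  · obtain ⟨k₀, hk₀, hk₀e⟩ := Finset.mem_image.1 h
    have : (range w.length).filter (fun k => stLinkOf ℓ = stEdgeAt x w k) = {k₀} := by
      ext k
      simp only [Finset.mem_filter, Finset.mem_range, Finset.mem_singleton]
      constructor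
      · rintro ⟨hk, he⟩
        rw [← hk₀e] at he
        exact hinj (by simpa using hk) (by simpa using Finset.mem_range.1 hk₀) he.symm
      · rintro rfl
        exact ⟨Finset.mem_range.1 hk₀, hk₀e.symm⟩
    rw [this, Finset.card_singleton, Nat.cast_one]
  · have : (range w.length).filter (fun k => stLinkOf ℓ = stEdgeAt x w k) = ∅ := by
      rw [Finset.filter_eq_empty_iff]
      intro k hk he
      exact h (Finset.mem_image.2 ⟨k, hk, he.symm⟩)
    rw [this, Finset.card_empty, Nat.cast_zero]

/-- The links of the window whose image lies in a set of ambient links (the pull-back of the set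
along the embedding `stLinkOf`). [cite: DennisEtAl2002, §4.2 (links of the finite window)] -/
noncomputable def stLinks (P : Finset (STALink L)) : Finset (STLink L T) :=
  P.preimage stLinkOf stLinkOf_injective.injOn

/-- Membership in `stLinks`: a link of the window belongs to the pull-back iff its image is in the set.
[cite: DennisEtAl2002, §4.2 (links of the finite window of T rounds)] -/
@[simp] theorem mem_stLinks {P : Finset (STALink L)} {ℓ : STLink L T} :
    ℓ ∈ stLinks P ↔ stLinkOf ℓ ∈ P := by
  rw [stLinks, Finset.mem_preimage]

/-- A set of ambient links in the window is the image of its pull-back. [cite: DennisEtAl2002, §4.2 (links of the finite window of T rounds)] -/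
theorem map_stLinks {P : Finset (STALink L)}
    (hP : ↑P ⊆ Set.range (stLinkOf : STLink L T → STALink L)) :
    (stLinks P : Finset (STLink L T)).map stLinkEmb = P := by
  ext a
  simp only [Finset.mem_map, mem_stLinks, stLinkEmb_apply]
  constructor
  · rintro ⟨ℓ, hℓ, rfl⟩; exact hℓ
  · intro ha
    obtain ⟨ℓ, rfl⟩ := hP ha
    exact ⟨ℓ, ha, rfl⟩

/-- A set of ambient links in the window has as many links as its pull-back. [cite: DennisEtAl2002, §4.2 (links of the finite window of T rounds)] -/
theorem card_stLinks {P : Finset (STALink L)}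
    (hP : ↑P ⊆ Set.range (stLinkOf : STLink L T → STALink L)) :
    (stLinks P : Finset (STLink L T)).card = P.card := by
  have h := congrArg Finset.card (map_stLinks hP)
  rwa [Finset.card_map] at h

/-- The support of the history of a path with distinct links is the pull-back of its link set.
[cite: DennisEtAl2002, §4.4 (n_E(ℓ) ∈ {0,1})] -/
theorem supp_stPolygonChain [NeZero L] {x : STASite L} {w : List (Fin 3 × Bool)}
    (hinj : Set.InjOn (stEdgeAt x w) (Set.Iio w.length)) :
    supp (stPolygonChain x w : History L T) = stLinks (stPolygonEdges x w) := by
  classical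
  ext ℓ
  simp only [supp, Finset.mem_filter, Finset.mem_univ, true_and, stPolygonChain_apply hinj, mem_stLinks]
  split_ifs with h <;> simp [h]

/-- The history of a self-avoiding polygon in the window has `ℓ = |w|` links.
[cite: DennisEtAl2002, §5.2 (polygon of length H)] -/
theorem hammingNorm_stPolygonChain [NeZero L] {x : STASite L} {w : List (Fin 3 × Bool)}
    (hP : IsSTPolygon x w)
    (hsub : ↑(stPolygonEdges x w) ⊆ Set.range (stLinkOf : STLink L T → STALink L)) :
    hammingNorm (stPolygonChain x w : History L T) = w.length := by
  classical
  have h1 : hammingNorm (stPolygonChain x w : History L T) = (supp (stPolygonChain x w : History L T)).card := rfl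
  rw [h1, supp_stPolygonChain hP.stEdgeAt_injOn, card_stLinks hsub, hP.card_stPolygonEdges]

/-! ### A link is determined by its end sites; counting polygons by walks of `ℤ³` -/

/-- For `L ≥ 3` no two unit vectors of the torus (equal or not) sum to zero. [folklore] -/
private theorem dir_add_dir_ne_zero' (hL : 3 ≤ L) (i j : Fin 2) : (dir i : Vertex L) + dir j ≠ 0 := by
  intro h
  have hi := congrFun h i
  simp only [dir, Pi.add_apply, Pi.single_eq_same, Pi.single_apply, Pi.zero_apply] at hi
  split_ifs at hi with hji
  · have h2 : ((2 : ℕ) : ZMod L) = 0 := by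
      rw [show ((2 : ℕ) : ZMod L) = 1 + 1 by norm_num]
      exact hi
    rw [ZMod.natCast_eq_zero_iff] at h2
    have := Nat.le_of_dvd (by norm_num) h2
    omega
  · rw [add_zero] at hi
    haveI : Fact (1 < L) := ⟨by omega⟩
    exact one_ne_zero hi

/-- **An ambient link is determined by its two end sites** (`L ≥ 3`).
[cite: DennisEtAl2002, §4.2 (links of the space-time lattice)] -/
theorem stEnds_injective (hL : 3 ≤ L) : Function.Injective (stEnds : STALink L → Sym2 (STASite L)) := by
  rintro (⟨⟨u, i⟩, τ⟩ | ⟨v, τ⟩) (⟨⟨u', i'⟩, τ'⟩ | ⟨v', τ'⟩) h <;>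
    simp only [stEnds, Sym2.eq_iff, Prod.mk.injEq] at h
  · rcases h with ⟨⟨rfl, rfl⟩, h2, -⟩ | ⟨⟨h1, rfl⟩, h2, -⟩
    · have : (⟨u, i⟩ : Edge L) = ⟨u, i'⟩ :=
        toSym2_injective hL (by simp only [toSym2, h2])
      rw [this]
    · exfalso
      rw [h1, add_assoc] at h2
      exact dir_add_dir_ne_zero' hL i' i (add_eq_left.1 h2)
  · exfalso
    rcases h with ⟨⟨-, h1⟩, -, h2⟩ | ⟨⟨-, h1⟩, -, h2⟩ <;> omega
  · exfalso
    rcases h with ⟨⟨-, h1⟩, -, h2⟩ | ⟨⟨-, h1⟩, -, h2⟩ <;> omega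
  · rcases h with ⟨⟨rfl, rfl⟩, -⟩ | ⟨⟨rfl, h1⟩, -, h2⟩
    · rfl
    · exfalso; omega

/-- Reconstruction of a polygon from a start site of the window and all but its last step: the
pull-back of the links of the truncated path together with every link of the window joining its
last site to the start. [folklore] -/
private noncomputable def stRebuild [NeZero L] (xu : STSite L T × List (Fin 3 × Bool)) : Finset (STLink L T) :=
  stLinks (stPolygonEdges (stSiteOf xu.1) xu.2) ∪
    univ.filter fun ℓ => stEnds (stLinkOf ℓ) = s(stPos (stSiteOf xu.1) xu.2 xu.2.length, stSiteOf xu.1)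

/-- A self-avoiding polygon of the window is recovered from its start site and its first `ℓ - 1`
steps (`L ≥ 3`: the last link is the unique link joining the last site to the start).
[cite: DennisEtAl2002, §5.3 (polygons counted by self-avoiding walks)] -/
private theorem stRebuild_eq [NeZero L] (hL : 3 ≤ L) {x₀ : STSite L T} {w : List (Fin 3 × Bool)}
    (hP : IsSTPolygon (stSiteOf x₀) w) :
    stRebuild (x₀, w.take (w.length - 1)) = stLinks (stPolygonEdges (stSiteOf x₀) w) := by
  classical
  have h3 := hP.three_le
  set n := w.length - 1 with hn
  set x := stSiteOf x₀ with hx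
  have hlen : (w.take n).length = n := by rw [List.length_take]; omega
  have hw : w.length = n + 1 := by omega
  ext ℓ
  simp only [stRebuild, stPolygonEdges, Finset.mem_union, Finset.mem_filter, Finset.mem_univ, true_and,
    Finset.mem_image, Finset.mem_range, mem_stLinks]
  rw [hlen]
  constructor
  · rintro (⟨k, hk, hke⟩ | h)
    · exact ⟨k, by omega, by rw [← hke, stEdgeAt_take x w hk]⟩
    · refine ⟨n, by omega, stEnds_injective hL ?_⟩
      rw [stEnds_stEdgeAt x w (by omega), h, stPos_take x w le_rfl, ← hw, hP.closed]
  · rintro ⟨k, hk, hke⟩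
    rcases lt_or_eq_of_le (Nat.le_of_lt_succ (hw ▸ hk)) with hk' | rfl
    · exact Or.inl ⟨k, hk', by rw [stEdgeAt_take x w hk', hke]⟩
    · right
      rw [← hke, stEnds_stEdgeAt x w (by omega), stPos_take x w le_rfl, ← hw, hP.closed]

/-- **`n_SAP(ℓ) ≤ L²(T+1) · c_{ℓ-1}(ℤ³)`**: the pull-backs of the link sets of the self-avoiding
polygons with `ℓ` links, all in the `T`-round window of the `L × L` toric code (`L ≥ 3`), number
at most `L²(T+1)` (start sites: "Such an SAW can begin at any one of `L²·T` lattice sites") times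
the number `c_{ℓ-1}(ℤ³) = #sawWords 3 (ℓ-1)` of `(ℓ-1)`-step self-avoiding walks of `ℤ³`
(`Word.card_sawWords`: `= SAW.Zd.count 3 (ℓ-1)`). [cite: DennisEtAl2002, §5.2 eq. (saw_L) and §5.3 eqs. (saw_d), (saw_3)] -/
theorem card_stPolygons_le [NeZero L] (hL : 3 ≤ L) (H : ℕ) (𝒮 : Finset (Finset (STLink L T)))
    (h𝒮 : ∀ P ∈ 𝒮, ∃ (x : STASite L) (w : List (Fin 3 × Bool)), IsSTPolygon x w ∧ w.length = H ∧
      ↑(stPolygonEdges x w) ⊆ Set.range (stLinkOf : STLink L T → STALink L) ∧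
      stLinks (stPolygonEdges x w) = P) :
    𝒮.card ≤ L ^ 2 * (T + 1) * (Word.sawWords 3 (H - 1)).card := by
  classical
  have hsub : 𝒮 ⊆ ((univ : Finset (STSite L T)) ×ˢ Word.sawWords 3 (H - 1)).image stRebuild := by
    intro P hP
    obtain ⟨x, w, hPw, hH, hrange, rfl⟩ := h𝒮 P hP
    have h3 := hPw.three_le
    obtain ⟨x₀, rfl⟩ := mem_range_stSiteOf_of_stPolygonEdges_subset (by omega) hrange
    refine Finset.mem_image.2 ⟨(x₀, w.take (w.length - 1)), ?_, stRebuild_eq hL hPw⟩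
    rw [Finset.mem_product]
    refine ⟨Finset.mem_univ _, ?_⟩
    rw [Word.mem_sawWords]
    exact ⟨by simp; omega, hPw.isSAW_take⟩
  calc 𝒮.card ≤ (((univ : Finset (STSite L T)) ×ˢ Word.sawWords 3 (H - 1)).image stRebuild).card :=
        Finset.card_le_card hsub
    _ ≤ ((univ : Finset (STSite L T)) ×ˢ Word.sawWords 3 (H - 1)).card := Finset.card_image_le
    _ = L ^ 2 * (T + 1) * (Word.sawWords 3 (H - 1)).card := by
        rw [Finset.card_product, Finset.card_univ]
        congr 1
        simp [STSite, Vertex, TorusSite, ZMod.card, Fintype.card_fin, Fintype.card_prod]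

end ToricCode

end Literature.InformationTheory.QuantumCodes
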